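import Mathlib
import Literature.Probability.RandomPlanarGeometry.SLECardyFlow
import Literature.Probability.RandomPlanarGeometry.CardyFunctionIncBeta
import HarnessLib

/-!
# Shape rigidity of the one-sided far-field identities: `κ = 6` and Cardy's ODE

Topic `Literature/Probability/RandomPlanarGeometry`; theorems only (calculus and algebra of the
one-sided cross-ratio `η = cardyEta X⁰ X¹ X²`, `SLECardyFlow.lean`).

Context (Lawler–Schramm–Werner 2001 §3, Werner 2007 §3; the crux line `crossing-martingale` of
`CardyRigidity`, stmt-CriticalPhenomena-0746).  If a regular Loewner driving process `W` makes the
level-stopped one-sided observables `φ(η_t)` martingales, the far-field expansion of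
`E φ(η_t)` for marks `L·x̂`, `L → ∞`, gives at order `L⁻²`, for EVERY mark shape
`0 < x̂₀ < x̂₁ < x̂₂`, the identity

  `4 φ'(η̂) S₂(x̂) + m₂ (φ''(η̂) S₁(x̂)² + φ'(η̂) S₃(x̂)) = 0`,   `m₂ = E W₁²`, `η̂ = cardyEta x̂`,

where `S₁ = Σᵢ ∂ᵢη`, `S₃ = Σᵢⱼ ∂ᵢⱼη` (first/second derivative along the translation family
`s ↦ cardyEta (x̂₀+s) (x̂₁+s) (x̂₂+s)`) and `S₂ = Σᵢ ∂ᵢη/x̂ᵢ` (derivative along the Loewner drift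
family `s ↦ cardyEta (x̂₀+s/x̂₀) (x̂₁+s/x̂₁) (x̂₂+s/x̂₂)`).  This file proves:

* closed forms: `cardyEta_translate` (the translation family is `(c-b)/(c-a) · (a+s)/(b+s)`),
  the derivatives `deriv_comp_cardyEta_translate`, `deriv_deriv_comp_cardyEta_translate`,
  `deriv_comp_cardyEta_drift` of `φ ∘ family` at `s = 0` in terms of `φ'(η̂)`, `φ''(η̂)` and the
  explicit rational shape functions;
* **shape rigidity** `cardy_ode_of_shapeIdentity`: two explicit shapes in the fibre of each
  `η ∈ (0,1)` — `(1, (1+η)/(2η), (1+η)/η)` and `(1, (1+3η)/(4η), (1+3η)/(3η))` — turn the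
  identities into `m₂ = 6` AND Cardy's equation `3η(1-η) φ'' + 2(1-2η) φ' = 0` wherever
  `φ' ≠ 0`, and into `φ'' = 0` wherever `φ' = 0` once `m₂ ≠ 0` (`cardy_ode_of_shapeIdentities`);
* **integration** `exists_eqOn_cardyFunction_affine_of_ode`: a `C²` solution of Cardy's
  equation on `(0,1)` is `A · cardyFunction + B` there (`hasDerivAt_cardyFunction_holds`).

So the one-sided family pins `κ = 6` and the kernel simultaneously (the percolation-free half of
"locality ⇔ κ = 6 ⇔ Cardy").  A θ-averaged (distributional) special form of the elimination, tied
to the crux's `HasFarFieldIdentities`, was landed Summits-side in parallel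
(`Summits/CriticalPhenomena/CardyFormulaZ2/Theorems/CardyUniqueLimitCardyRigidityAffineBeta.lean`,
`AffineBeta.algebra_step` at the bases `(2η/(1+η),1,2)`, `(4η/(η+3),1,4)`); this file is the
pointwise, crux-independent Literature statement (any `φ', φ'', m`, all shapes).  Mathlib:
`HasDerivAt` calculus only.

References: G. Lawler, O. Schramm, W. Werner, Acta Math. 187 (2001), §3; W. Werner, *Lectures on
two-dimensional critical percolation* (2007), §3; J. Cardy, J. Phys. A 25 (1992), eq. (8).
-/

noncomputable section

open Set Filter Topology

namespace Literature.Probability.RandomPlanarGeometry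

/-! ### The translation family `s ↦ cardyEta (a+s) (b+s) (c+s)` -/

/-- Along a simultaneous translation of the three marks the cross-ratio is a Möbius function of
the parameter: `cardyEta (a+s) (b+s) (c+s) = (c-b)/(c-a) · (a+s)/(b+s)`. [folklore] -/
theorem cardyEta_translate {a b c s : ℝ} (hb : b + s ≠ 0) (hca : c - a ≠ 0) :
    cardyEta (a + s) (b + s) (c + s) = (c - b) / (c - a) * ((a + s) / (b + s)) := by
  unfold cardyEta
  have h1 : c + s - (b + s) = c - b := by ring
  have h2 : c + s - (a + s) = c - a := by ring
  rw [h1, h2]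
  field_simp

/-- Derivative of the translation family: `d/ds cardyEta (a+s) (b+s) (c+s) =
(c-b)/(c-a) · (b-a)/(b+s)²`. [folklore] -/
theorem hasDerivAt_cardyEta_translate {a b c s : ℝ} (hs : -b < s) (hca : c - a ≠ 0) :
    HasDerivAt (fun s ↦ cardyEta (a + s) (b + s) (c + s))
      ((c - b) / (c - a) * ((b - a) / (b + s) ^ 2)) s := by
  have hbs : ∀ᶠ u in 𝓝 s, b + u ≠ 0 := by
    filter_upwards [lt_mem_nhds hs] with u hu
    exact (by linarith : 0 < b + u).ne'
  have hbs0 : b + s ≠ 0 := (by linarith : 0 < b + s).ne'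
  have hquot : HasDerivAt (fun u ↦ (a + u) / (b + u)) ((1 * (b + s) - (a + s) * 1) / (b + s) ^ 2) s :=
    ((hasDerivAt_id s).const_add a).div ((hasDerivAt_id s).const_add b) hbs0
  have h := hquot.const_mul ((c - b) / (c - a))
  refine (h.congr_of_eventuallyEq ?_).congr_deriv (by field_simp; ring)
  filter_upwards [hbs] with u hu
  rw [cardyEta_translate hu hca]

/-- Derivative of the slope of the translation family:
`d/ds [(c-b)/(c-a) · (b-a)/(b+s)²] = -2 (c-b)(b-a)/((c-a)(b+s)³)`. [folklore] -/
theorem hasDerivAt_translateSlope {a b c s : ℝ} (hs : -b < s) :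
    HasDerivAt (fun u ↦ (c - b) / (c - a) * ((b - a) / (b + u) ^ 2))
      (-2 * ((c - b) * (b - a) / ((c - a) * (b + s) ^ 3))) s := by
  have hbs0 : b + s ≠ 0 := (by linarith : 0 < b + s).ne'
  have hmul : HasDerivAt (fun u ↦ (b + u) * (b + u)) (1 * (b + s) + (b + s) * 1) s :=
    ((hasDerivAt_id s).const_add b).mul ((hasDerivAt_id s).const_add b)
  have hpow : HasDerivAt (fun u ↦ (b + u) ^ 2) (1 * (b + s) + (b + s) * 1) s :=
    hmul.congr_of_eventuallyEq (Eventually.of_forall fun u ↦ by simp [sq])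
  have hinv : HasDerivAt (fun u ↦ (b - a) / (b + u) ^ 2)
      ((0 * (b + s) ^ 2 - (b - a) * (1 * (b + s) + (b + s) * 1)) / ((b + s) ^ 2) ^ 2) s :=
    (hasDerivAt_const s (b - a)).div hpow (pow_ne_zero 2 hbs0)
  refine (hinv.const_mul ((c - b) / (c - a))).congr_deriv ?_
  by_cases hca : c - a = 0
  · simp [hca]
  field_simp
  ring

/-- Second derivative of the translation family:
`d²/ds² cardyEta (a+s) (b+s) (c+s) = -2 (c-b)(b-a)/((c-a)(b+s)³)`. [folklore] -/
theorem hasDerivAt_deriv_cardyEta_translate {a b c s : ℝ} (hs : -b < s) (hca : c - a ≠ 0) :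
    HasDerivAt (deriv fun s ↦ cardyEta (a + s) (b + s) (c + s))
      (-2 * ((c - b) * (b - a) / ((c - a) * (b + s) ^ 3))) s := by
  have hev : deriv (fun s ↦ cardyEta (a + s) (b + s) (c + s)) =ᶠ[𝓝 s]
      fun u ↦ (c - b) / (c - a) * ((b - a) / (b + u) ^ 2) := by
    filter_upwards [lt_mem_nhds hs] with u hu
    exact (hasDerivAt_cardyEta_translate hu hca).deriv
  exact (hasDerivAt_translateSlope hs).congr_of_eventuallyEq hev

/-! ### Composite derivatives: a test function read along the translation family -/

section Composite

variable {φ φ' : ℝ → ℝ} {p q a b c : ℝ}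

/-- For admissible marks `0 < a < b < c` the translation family stays in `(0,1)` near `s = 0`.
[folklore] -/
theorem eventually_cardyEta_translate_mem_Ioo (ha : 0 < a) (hab : a < b) (hbc : b < c) :
    ∀ᶠ s in 𝓝 (0 : ℝ), cardyEta (a + s) (b + s) (c + s) ∈ Ioo (0 : ℝ) 1 := by
  filter_upwards [lt_mem_nhds (neg_lt_zero.2 ha)] with s hs
  exact cardyEta_mem_Ioo (by linarith) (by linarith) (by linarith)

/-- **First derivative along the translation family**: for `φ` differentiable at
`η̂ = cardyEta a b c`, `d/ds φ(cardyEta (a+s) (b+s) (c+s)) |₀ = φ'(η̂) · (c-b)(b-a)/((c-a) b²)`.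
[cite: Werner2007, §3] -/
theorem deriv_comp_cardyEta_translate (ha : 0 < a) (hab : a < b) (hbc : b < c)
    (hφ : HasDerivAt φ p (cardyEta a b c)) :
    deriv (fun s ↦ φ (cardyEta (a + s) (b + s) (c + s))) 0 =
      p * ((c - b) * (b - a) / ((c - a) * b ^ 2)) := by
  have hca : c - a ≠ 0 := by linarith
  have hg := hasDerivAt_cardyEta_translate (s := 0) (a := a) (c := c) (by linarith : -b < 0) hca
  have hg0 : cardyEta (a + 0) (b + 0) (c + 0) = cardyEta a b c := by simp
  rw [← hg0] at hφ
  have hcomp : HasDerivAt (fun s ↦ φ (cardyEta (a + s) (b + s) (c + s)))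
      (p * ((c - b) / (c - a) * ((b - a) / (b + 0) ^ 2))) 0 := hφ.comp 0 hg
  rw [hcomp.deriv]
  simp only [add_zero]
  field_simp

/-- **Second derivative along the translation family**: for `φ` differentiable on `(0,1)` with
derivative `φ'`, itself differentiable at `η̂ = cardyEta a b c` with derivative `q`,
`d²/ds² φ(cardyEta (a+s) (b+s) (c+s)) |₀ = q S₁² + φ'(η̂) S₃` with `S₁ = (c-b)(b-a)/((c-a)b²)`,
`S₃ = -2 (c-b)(b-a)/((c-a)b³)`. [cite: Werner2007, §3] -/
theorem deriv_deriv_comp_cardyEta_translate (ha : 0 < a) (hab : a < b) (hbc : b < c)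
    (hφ : ∀ y ∈ Ioo (0 : ℝ) 1, HasDerivAt φ (φ' y) y) (hφ' : HasDerivAt φ' q (cardyEta a b c)) :
    deriv (deriv fun s ↦ φ (cardyEta (a + s) (b + s) (c + s))) 0 =
      q * ((c - b) * (b - a) / ((c - a) * b ^ 2)) ^ 2 +
        φ' (cardyEta a b c) * (-2 * ((c - b) * (b - a) / ((c - a) * b ^ 3))) := by
  have hca : c - a ≠ 0 := by linarith
  set g : ℝ → ℝ := fun s ↦ cardyEta (a + s) (b + s) (c + s) with hgdef
  set g₁ : ℝ → ℝ := fun u ↦ (c - b) / (c - a) * ((b - a) / (b + u) ^ 2) with hg₁def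
  have hg : ∀ s, -b < s → HasDerivAt g (g₁ s) s := fun s hs ↦
    hasDerivAt_cardyEta_translate hs hca
  -- near `0` the first derivative is `φ'(g s) · g₁ s`
  have hev : deriv (fun s ↦ φ (g s)) =ᶠ[𝓝 0] fun s ↦ φ' (g s) * g₁ s := by
    filter_upwards [eventually_cardyEta_translate_mem_Ioo ha hab hbc,
      lt_mem_nhds (neg_lt_zero.2 (ha.trans hab))] with s hs hsb
    exact ((hφ (g s) hs).comp s (hg s hsb)).deriv
  rw [hev.deriv_eq]
  have hg0 : g 0 = cardyEta a b c := by simp [hgdef]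
  have hφ'0 : HasDerivAt φ' q (g 0) := by rw [hg0]; exact hφ'
  have h1 : HasDerivAt (fun s ↦ φ' (g s)) (q * g₁ 0) 0 := hφ'0.comp 0 (hg 0 (by linarith))
  have h2 : HasDerivAt g₁ (-2 * ((c - b) * (b - a) / ((c - a) * (b + 0) ^ 3))) 0 :=
    hasDerivAt_translateSlope (by linarith)
  have hmul : HasDerivAt (fun s ↦ φ' (g s) * g₁ s)
      (q * g₁ 0 * g₁ 0 + φ' (g 0) * (-2 * ((c - b) * (b - a) / ((c - a) * (b + 0) ^ 3)))) 0 :=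
    h1.mul h2
  rw [hmul.deriv, hg0]
  have hb0 : b ≠ 0 := (ha.trans hab).ne'
  simp only [hg₁def, add_zero]
  field_simp

/-! ### The Loewner drift family `s ↦ cardyEta (a+s/a) (b+s/b) (c+s/c)` -/

/-- Derivative at `s = 0` along the Loewner drift direction `(1/a, 1/b, 1/c)` (the marks move by
`2 dt / Xⁱ` under the Loewner flow): `S₂ = (b-a)(c-b)(ab+bc+ca)/(a b³ c (c-a))`.
[cite: Lawler2005, §4.1] -/
theorem hasDerivAt_cardyEta_drift (ha : 0 < a) (hab : a < b) (hbc : b < c) :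
    HasDerivAt (fun s ↦ cardyEta (a + s / a) (b + s / b) (c + s / c))
      ((b - a) * (c - b) * (a * b + b * c + c * a) / (a * b ^ 3 * c * (c - a))) 0 := by
  have ha0 : a ≠ 0 := ha.ne'
  have hb0 : b ≠ 0 := (ha.trans hab).ne'
  have hc0 : c ≠ 0 := (ha.trans (hab.trans hbc)).ne'
  have hx : HasDerivAt (fun s ↦ a + s / a) (1 / a) 0 := ((hasDerivAt_id 0).div_const a).const_add a
  have hy : HasDerivAt (fun s ↦ b + s / b) (1 / b) 0 := ((hasDerivAt_id 0).div_const b).const_add b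
  have hz : HasDerivAt (fun s ↦ c + s / c) (1 / c) 0 := ((hasDerivAt_id 0).div_const c).const_add c
  have hN : HasDerivAt (fun s ↦ (a + s / a) * ((c + s / c) - (b + s / b)))
      (1 / a * ((c + 0 / c) - (b + 0 / b)) + (a + 0 / a) * (1 / c - 1 / b)) 0 := hx.mul (hz.sub hy)
  have hD : HasDerivAt (fun s ↦ (b + s / b) * ((c + s / c) - (a + s / a)))
      (1 / b * ((c + 0 / c) - (a + 0 / a)) + (b + 0 / b) * (1 / c - 1 / a)) 0 := hy.mul (hz.sub hx)
  have hD0 : (b + 0 / b) * ((c + 0 / c) - (a + 0 / a)) ≠ 0 := by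
    simp only [zero_div, add_zero]; exact mul_ne_zero hb0 (by linarith)
  have h : HasDerivAt (fun s ↦ cardyEta (a + s / a) (b + s / b) (c + s / c)) _ 0 := hN.div hD hD0
  refine h.congr_deriv ?_
  have hca : c - a ≠ 0 := by linarith
  simp only [zero_div, add_zero]
  field_simp
  ring

/-- **First derivative along the drift family**: for `φ` differentiable at `η̂ = cardyEta a b c`,
`d/ds φ(cardyEta (a+s/a) (b+s/b) (c+s/c)) |₀ = φ'(η̂) S₂`. [cite: Lawler2005, §4.1] -/
theorem deriv_comp_cardyEta_drift (ha : 0 < a) (hab : a < b) (hbc : b < c)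
    (hφ : HasDerivAt φ p (cardyEta a b c)) :
    deriv (fun s ↦ φ (cardyEta (a + s / a) (b + s / b) (c + s / c))) 0 =
      p * ((b - a) * (c - b) * (a * b + b * c + c * a) / (a * b ^ 3 * c * (c - a))) := by
  have hg := hasDerivAt_cardyEta_drift ha hab hbc
  have hg0 : cardyEta (a + 0 / a) (b + 0 / b) (c + 0 / c) = cardyEta a b c := by simp
  rw [← hg0] at hφ
  have hcomp : HasDerivAt (fun s ↦ φ (cardyEta (a + s / a) (b + s / b) (c + s / c))) _ 0 :=
    hφ.comp 0 hg
  rw [hcomp.deriv]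

end Composite

/-! ### Shape rigidity: two fibre shapes pin `m₂ = 6` and Cardy's equation -/

section Algebra


/-- The first fibre shape `(1, (1+η)/(2η), (1+η)/η)` has cross-ratio `η`. [folklore] -/
theorem cardyEta_fibreShape₁ {η : ℝ} (hη : η ∈ Ioo (0 : ℝ) 1) :
    cardyEta 1 ((1 + η) / (2 * η)) ((1 + η) / η) = η := by
  have h0 : η ≠ 0 := hη.1.ne'
  have h1 : 1 + η ≠ 0 := by linarith [hη.1]
  unfold cardyEta
  field_simp
  ring

/-- The second fibre shape `(1, (1+3η)/(4η), (1+3η)/(3η))` has cross-ratio `η`. [folklore] -/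
theorem cardyEta_fibreShape₂ {η : ℝ} (hη : η ∈ Ioo (0 : ℝ) 1) :
    cardyEta 1 ((1 + 3 * η) / (4 * η)) ((1 + 3 * η) / (3 * η)) = η := by
  have h0 : η ≠ 0 := hη.1.ne'
  have h1 : 1 + 3 * η ≠ 0 := by linarith [hη.1]
  have h1' : 1 + η * 3 ≠ 0 := by linarith [hη.1]
  unfold cardyEta
  field_simp
  ring

/-- Ordering of the first fibre shape: `0 < 1 < (1+η)/(2η) < (1+η)/η`. [folklore] -/
theorem fibreShape₁_ordered {η : ℝ} (hη : η ∈ Ioo (0 : ℝ) 1) :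
    (1 : ℝ) < (1 + η) / (2 * η) ∧ (1 + η) / (2 * η) < (1 + η) / η := by
  obtain ⟨h0, h1⟩ := hη
  constructor
  · rw [lt_div_iff₀ (by positivity)]; linarith
  · rw [div_lt_div_iff₀ (by positivity) h0]; nlinarith

/-- Ordering of the second fibre shape: `0 < 1 < (1+3η)/(4η) < (1+3η)/(3η)`. [folklore] -/
theorem fibreShape₂_ordered {η : ℝ} (hη : η ∈ Ioo (0 : ℝ) 1) :
    (1 : ℝ) < (1 + 3 * η) / (4 * η) ∧ (1 + 3 * η) / (4 * η) < (1 + 3 * η) / (3 * η) := by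
  obtain ⟨h0, h1⟩ := hη
  constructor
  · rw [lt_div_iff₀ (by positivity)]; linarith
  · rw [div_lt_div_iff₀ (by positivity) (by positivity)]; nlinarith

/-- The far-field identity at the first fibre shape, cleared of its nonzero factor
`η(1-η)/(1+η)²`: `4p(1+4η) + m q η(1-η) - 4 m p η = 0`. [folklore] -/
theorem fibreShape₁_reduce {η p q m : ℝ} (hη : η ∈ Ioo (0 : ℝ) 1)
    (h : 4 * p * ((((1 + η) / (2 * η)) - (1)) * (((1 + η) / η) - ((1 + η) / (2 * η))) * ((1) * ((1 + η) / (2 * η)) + ((1 + η) / (2 * η)) * ((1 + η) / η) + ((1 + η) / η) * (1)) / ((1) * ((1 + η) / (2 * η)) ^ 3 * ((1 + η) / η) * (((1 + η) / η) - (1)))) +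
      m * (q * ((((1 + η) / η) - ((1 + η) / (2 * η))) * (((1 + η) / (2 * η)) - (1)) / ((((1 + η) / η) - (1)) * ((1 + η) / (2 * η)) ^ 2)) ^ 2 +
        p * (-2 * ((((1 + η) / η) - ((1 + η) / (2 * η))) * (((1 + η) / (2 * η)) - (1)) / ((((1 + η) / η) - (1)) * ((1 + η) / (2 * η)) ^ 3)))) = 0) :
    4 * p * (1 + 4 * η) + m * q * η * (1 - η) - 4 * m * p * η = 0 := by
  obtain ⟨h0, h1⟩ := hη
  have h0' : η ≠ 0 := h0.ne'
  have h1' : 1 - η ≠ 0 := by linarith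
  have h2' : 1 + η ≠ 0 := by linarith
  have key : 4 * p * ((((1 + η) / (2 * η)) - (1)) * (((1 + η) / η) - ((1 + η) / (2 * η))) * ((1) * ((1 + η) / (2 * η)) + ((1 + η) / (2 * η)) * ((1 + η) / η) + ((1 + η) / η) * (1)) / ((1) * ((1 + η) / (2 * η)) ^ 3 * ((1 + η) / η) * (((1 + η) / η) - (1)))) +
      m * (q * ((((1 + η) / η) - ((1 + η) / (2 * η))) * (((1 + η) / (2 * η)) - (1)) / ((((1 + η) / η) - (1)) * ((1 + η) / (2 * η)) ^ 2)) ^ 2 +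
        p * (-2 * ((((1 + η) / η) - ((1 + η) / (2 * η))) * (((1 + η) / (2 * η)) - (1)) / ((((1 + η) / η) - (1)) * ((1 + η) / (2 * η)) ^ 3)))) =
      η * (1 - η) / (1 + η) ^ 2 * (4 * p * (1 + 4 * η) + m * q * η * (1 - η) - 4 * m * p * η) := by
    field_simp
    ring
  rw [key] at h
  have hfac : η * (1 - η) / (1 + η) ^ 2 ≠ 0 := by positivity
  exact (mul_eq_zero.1 h).resolve_left hfac

/-- The far-field identity at the second fibre shape, cleared of its nonzero factor
`η(1-η)/(1+3η)²`: `4p(1+10η) + m q η(1-η) - 8 m p η = 0`. [folklore] -/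
theorem fibreShape₂_reduce {η p q m : ℝ} (hη : η ∈ Ioo (0 : ℝ) 1)
    (h : 4 * p * ((((1 + 3 * η) / (4 * η)) - (1)) * (((1 + 3 * η) / (3 * η)) - ((1 + 3 * η) / (4 * η))) * ((1) * ((1 + 3 * η) / (4 * η)) + ((1 + 3 * η) / (4 * η)) * ((1 + 3 * η) / (3 * η)) + ((1 + 3 * η) / (3 * η)) * (1)) / ((1) * ((1 + 3 * η) / (4 * η)) ^ 3 * ((1 + 3 * η) / (3 * η)) * (((1 + 3 * η) / (3 * η)) - (1)))) +
      m * (q * ((((1 + 3 * η) / (3 * η)) - ((1 + 3 * η) / (4 * η))) * (((1 + 3 * η) / (4 * η)) - (1)) / ((((1 + 3 * η) / (3 * η)) - (1)) * ((1 + 3 * η) / (4 * η)) ^ 2)) ^ 2 +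
        p * (-2 * ((((1 + 3 * η) / (3 * η)) - ((1 + 3 * η) / (4 * η))) * (((1 + 3 * η) / (4 * η)) - (1)) / ((((1 + 3 * η) / (3 * η)) - (1)) * ((1 + 3 * η) / (4 * η)) ^ 3)))) = 0) :
    4 * p * (1 + 10 * η) + m * q * η * (1 - η) - 8 * m * p * η = 0 := by
  obtain ⟨h0, h1⟩ := hη
  have h0' : η ≠ 0 := h0.ne'
  have h1' : 1 - η ≠ 0 := by linarith
  have h2' : 1 + 3 * η ≠ 0 := by linarith
  have key : 4 * p * ((((1 + 3 * η) / (4 * η)) - (1)) * (((1 + 3 * η) / (3 * η)) - ((1 + 3 * η) / (4 * η))) * ((1) * ((1 + 3 * η) / (4 * η)) + ((1 + 3 * η) / (4 * η)) * ((1 + 3 * η) / (3 * η)) + ((1 + 3 * η) / (3 * η)) * (1)) / ((1) * ((1 + 3 * η) / (4 * η)) ^ 3 * ((1 + 3 * η) / (3 * η)) * (((1 + 3 * η) / (3 * η)) - (1)))) +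
      m * (q * ((((1 + 3 * η) / (3 * η)) - ((1 + 3 * η) / (4 * η))) * (((1 + 3 * η) / (4 * η)) - (1)) / ((((1 + 3 * η) / (3 * η)) - (1)) * ((1 + 3 * η) / (4 * η)) ^ 2)) ^ 2 +
        p * (-2 * ((((1 + 3 * η) / (3 * η)) - ((1 + 3 * η) / (4 * η))) * (((1 + 3 * η) / (4 * η)) - (1)) / ((((1 + 3 * η) / (3 * η)) - (1)) * ((1 + 3 * η) / (4 * η)) ^ 3)))) =
      η * (1 - η) / (1 + 3 * η) ^ 2 *
        (4 * p * (1 + 10 * η) + m * q * η * (1 - η) - 8 * m * p * η) := by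
    field_simp
    ring
  rw [key] at h
  have hfac : η * (1 - η) / (1 + 3 * η) ^ 2 ≠ 0 := by positivity
  exact (mul_eq_zero.1 h).resolve_left hfac

/-- **The two-shape algebra.**  The reduced identities at the two fibre shapes of `η ∈ (0,1)` with
`p = φ'(η) ≠ 0` force `m = 6` AND Cardy's equation `3η(1-η) q + 2(1-2η) p = 0`.
[cite: LawlerSchrammWerner2001, §3] -/
theorem six_and_cardyODE_of_reduced {η p q m : ℝ} (hη : η ∈ Ioo (0 : ℝ) 1) (hp : p ≠ 0)
    (h₁ : 4 * p * (1 + 4 * η) + m * q * η * (1 - η) - 4 * m * p * η = 0)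
    (h₂ : 4 * p * (1 + 10 * η) + m * q * η * (1 - η) - 8 * m * p * η = 0) :
    m = 6 ∧ 3 * η * (1 - η) * q + 2 * (1 - 2 * η) * p = 0 := by
  have hη0 : η ≠ 0 := hη.1.ne'
  -- `h₂ - h₁ : 4 p η (6 - m) = 0`
  have hm : m = 6 := by
    have hdiff : 4 * p * η * (6 - m) = 0 := by linear_combination h₂ - h₁
    have : 6 - m = 0 := by
      rcases mul_eq_zero.1 hdiff with h | h
      · exact absurd h (mul_ne_zero (mul_ne_zero (by norm_num) hp) hη0)
      · exact h
    linarith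
  subst hm
  refine ⟨rfl, ?_⟩
  linear_combination h₁ / 2

/-- **Shape rigidity of the one-sided far-field identities.**  If for ALL admissible mark
shapes `0 < a < b < c` the order-`L⁻²` far-field identity
`4 φ'(η̂) S₂ + m (φ''(η̂) S₁² + φ'(η̂) S₃) = 0` holds (`η̂ = cardyEta a b c`; `φ'`, `φ''` any two
functions, `m` any real — in the application `φ'`, `φ''` are the first two derivatives of the
kernel and `m = E W₁²`), then either `φ' = 0` on `(0,1)`, or `m = 6` and Cardy's equation
`3η(1-η) φ''(η) + 2(1-2η) φ'(η) = 0` holds at EVERY `η ∈ (0,1)` (where `φ'(η) = 0` the identity at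
one fibre shape gives `φ''(η) = 0`).  This is the one-sided version of "the Cardy–Smirnov
observable is an SLE_κ martingale iff `κ = 6`". [cite: LawlerSchrammWerner2001, §3] -/
theorem cardyODE_of_shapeIdentities {φ' φ'' : ℝ → ℝ} {m : ℝ}
    (h : ∀ a b c : ℝ, 0 < a → a < b → b < c →
      4 * φ' (cardyEta a b c) * (((b) - (a)) * ((c) - (b)) * ((a) * (b) + (b) * (c) + (c) * (a)) / ((a) * (b) ^ 3 * (c) * ((c) - (a)))) +
        m * (φ'' (cardyEta a b c) * (((c) - (b)) * ((b) - (a)) / (((c) - (a)) * (b) ^ 2)) ^ 2 + φ' (cardyEta a b c) * (-2 * (((c) - (b)) * ((b) - (a)) / (((c) - (a)) * (b) ^ 3)))) = 0) :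
    (∀ η ∈ Ioo (0 : ℝ) 1, φ' η = 0) ∨
      (m = 6 ∧ ∀ η ∈ Ioo (0 : ℝ) 1, 3 * η * (1 - η) * φ'' η + 2 * (1 - 2 * η) * φ' η = 0) := by
  -- the two reduced identities at every `η`
  have red : ∀ η ∈ Ioo (0 : ℝ) 1,
      (4 * φ' η * (1 + 4 * η) + m * φ'' η * η * (1 - η) - 4 * m * φ' η * η = 0) ∧
      (4 * φ' η * (1 + 10 * η) + m * φ'' η * η * (1 - η) - 8 * m * φ' η * η = 0) := by
    intro η hη
    obtain ⟨hb₁, hc₁⟩ := fibreShape₁_ordered hη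
    obtain ⟨hb₂, hc₂⟩ := fibreShape₂_ordered hη
    have e₁ := h 1 _ _ one_pos hb₁ hc₁
    have e₂ := h 1 _ _ one_pos hb₂ hc₂
    rw [cardyEta_fibreShape₁ hη] at e₁
    rw [cardyEta_fibreShape₂ hη] at e₂
    exact ⟨fibreShape₁_reduce hη e₁, fibreShape₂_reduce hη e₂⟩
  by_cases hex : ∃ η₀ ∈ Ioo (0 : ℝ) 1, φ' η₀ ≠ 0
  · right
    obtain ⟨η₀, hη₀, hp₀⟩ := hex
    obtain ⟨hm, -⟩ := six_and_cardyODE_of_reduced hη₀ hp₀ (red η₀ hη₀).1 (red η₀ hη₀).2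
    refine ⟨hm, fun η hη ↦ ?_⟩
    by_cases hp : φ' η = 0
    · -- the first reduced identity reads `m φ'' η (1-η) = 0`
      have e := (red η hη).1
      rw [hp, hm] at e
      have hq : φ'' η = 0 := by
        have hη' : η * (1 - η) ≠ 0 := mul_ne_zero hη.1.ne' (by linarith [hη.2])
        have : 6 * φ'' η * (η * (1 - η)) = 0 := by linear_combination e
        rcases mul_eq_zero.1 this with h' | h'
        · linarith
        · exact absurd h' hη'
      rw [hp, hq]; ring
    · exact (six_and_cardyODE_of_reduced hη hp (red η hη).1 (red η hη).2).2
  · left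
    push Not at hex
    exact hex

end Algebra

end Literature.Probability.RandomPlanarGeometry

end
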